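import Summits.AtomisticToContinuum.HydrodynamicLimit.Theorems.TwoClocksEquilibriumFastWindowLDStubBookkeeping
import Summits.AtomisticToContinuum.HydrodynamicLimit.Theorems.TwoClocksEquilibriumFastWindowLDStubOneSiteGauss
import Summits.AtomisticToContinuum.HydrodynamicLimit.Theorems.TwoClocksEquilibriumFastWindowLDStubStaticReduction
import Summits.AtomisticToContinuum.HydrodynamicLimit.Theorems.TwoClocksEquilibriumFastWindowLDStubDualFamily
import Summits.AtomisticToContinuum.HydrodynamicLimit.Theorems.TwoClocksEquilibriumFastWindowLDStubTruncation
import Summits.AtomisticToContinuum.HydrodynamicLimit.Theorems.TwoClocksEquilibriumFastWindowLDStubHolderSplit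
import Summits.AtomisticToContinuum.HydrodynamicLimit.Theses.TwoClocks

/-!
# `EquilibriumFastWindowLD` reduced to its bounded class, and to a uniform doubling gain for it
# (route TwoClocks, crux stmt-AtomisticToContinuum-14440; line `Sketch`, skeleton rev 2/3 compositions)

Helper file (`--supports stmt-AtomisticToContinuum-14440`) of the line lead. Write
`M^F_N(β, τ) := ∫⁻ exp(β Σᵢ w⁻¹∫₀ʷ F((Φ_N.flow r z)ᵢ) dr) dG_N`, `w = τ (N+1)^{-1/3}`, for the window
exponential moment of the crux (global canonical Gibbs law `G_N = localGibbsLaw σ a₀ u₀ θ₀ N Φ_N` with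
constant profiles) and `𝒢(C')` for the class of continuous one-body `G : 𝕋³ × ℝ³ → ℝ` with
`|G(x,v)| ≤ C'(1+|v|²)`, compact `v`-support, `M_{1,u₀,θ₀}`-orthogonal at every `x` to `1, v_j, |v|²`.
All six STATIC stubs of the line are landed theorems of this namespace:

* `stub_bookkeeping` — time-scale RG on an abstract window moment (quadratic seed + dyadic doubling
  with a uniform gain `η < 1` ⟹ decay);
* `stub_oneSiteGauss` — one-site Gaussian bound `≤ e^{Kt²}`, `|t| ≤ t₀(C, θ, u)`, uniform over centred
  `g` of weighted growth `C`;
* `stub_staticReduction` — one-site bound ⟹ `M_N(β, τ) ≤ e^{Kβ²(N+1)}` at every window;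
* `stub_dualFamily` — a continuous compactly supported dual family to `1, v_j − u_j, |v − u|²` under
  `M_{1,u,θ}`;
* `stub_truncation` — `F = G + T` with `G ∈ 𝒢(C+1)` and a tail `T` of one-site exponential moment
  `≤ e^{ϖ}` on a tilt range `|μ| ≤ μ₀` FIXED BEFORE `ϖ`;
* `stub_holderSplit` — `M^{G+T}(β) ≤ M^G(β/(1−ϑ))^{1−ϑ} · M^T(β/ϑ)^ϑ`.

Two sorry-free reductions, and their composition:

* `boundedWindowLD_of_doublingGainBounded` (THE RG STEP, S1 + S2 + S3): a uniform doubling gain for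
  the bounded class — for every `C' ≥ 0` a tilt range `β₁(C') > 0` uniform over `𝒢(C')`, and for
  every `G ∈ 𝒢(C')` a base scale `τ₀` and a gain `η < 1` with
  `M^G_N(β, 2T) ≤ e^{δ(N+1)} M^G_N(β/2, T)^{2(1+η)}` at every dyadic `T = 2ʲτ₀`, all `|β| ≤ β₁`,
  every slack `δ > 0`, eventually in `N` — gives THE CRUX RESTRICTED TO THE BOUNDED CLASS with the
  class-uniform tilt range `min t₀(C') β₁(C')`:
  `∀ G ∈ 𝒢(C') ∀ |β| ≤ min t₀ β₁ ∀ ε > 0 ∃ τ ∃ N₀ ∀ N ≥ N₀, M^G_N(β, τ) ≤ e^{ε(N+1)}`;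
* `EquilibriumFastWindowLD_of_boundedWindowLD` (THE NORMAL-FORM STEP, NF-a1 + NF-a2 + NF-b + S3):
  the crux restricted to the bounded class with a class-uniform tilt range implies the crux for
  every fast `F` of quadratic growth: `β₀ = min (β₁(C+1)/2) (μ₀/2)`; given `β ≠ 0` and `ε`, split
  `F = G + T` at tail size `ϖ = ε/2` with the β-proportional Hölder weight `ϑ = |β|/μ₀ ≤ ½` — the
  `T`-factor sits at the fixed tilt `±μ₀` and is static, the `G`-factor is the hypothesis at tilt
  `β/(1−ϑ)`, `|β/(1−ϑ)| ≤ 2|β| ≤ β₁` (uniformity of `β₁` over `𝒢(C+1)` is what lets `β₀` be chosen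
  before `ε`, on which `G` depends through the truncation radius);
* `EquilibriumFastWindowLD_of_doublingGainBounded` = the two composed (the registered composition
  rev 2 of the line's skeleton `Cruxes/EquilibriumFastWindowLD/Lines/Sketch.lean`).

Both hypotheses are open (each is false for free flight, like the crux; no fixed-density
long-kinetic-time decorrelation estimate at exponential scale is in print: BGSS 2023 are
Boltzmann–Grad and short-time / covariance-level). The weaker one — the crux for bounded,
compactly-`v`-supported fast observables with a tilt range uniform in the weighted sup-norm — is the
honest residue of the line: everything else (quadratic-growth tails, quantifier bookkeeping, statics)
is kernel-checked. Nothing dynamical is proved here.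

References: S. Olla, S. R. S. Varadhan, H.-T. Yau, Comm. Math. Phys. 155 (1993) 523, §2;
J.-D. Deuschel, D. W. Stroock, *Large Deviations* (1989) §5.4; H. Spohn, *Large Scale Dynamics of
Interacting Particles* (1991), Part I §2.3.

prover-line-stmt-AtomisticToContinuum-14440-c1-0 (composition written by
prover-line-stmt-AtomisticToContinuum-14440-0, skeleton rev 2).
-/

noncomputable section

open MeasureTheory ProbabilityTheory Real Set Filter
open scoped ENNReal BigOperators

namespace Summit.AtomisticToContinuum.HydrodynamicLimit.Theorems.FastWindowRG

open Literature.Analysis.FluidPDE Literature.MathematicalPhysics.KineticTheory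

/-- `ofReal (exp a)` raised to a real power `p ∈ [0, 1]` is bounded by `ofReal (exp b)` whenever
`a ≤ b` and `0 ≤ b`: `x ≤ ofReal (exp a) → x ^ p ≤ ofReal (exp b)`. [folklore] -/
theorem rpow_le_ofReal_exp_of_le_of_nonneg {x : ℝ≥0∞} {a b p : ℝ}
    (hx : x ≤ ENNReal.ofReal (Real.exp a)) (hab : a ≤ b) (hb : 0 ≤ b) (hp0 : 0 ≤ p) (hp1 : p ≤ 1) :
    x ^ p ≤ ENNReal.ofReal (Real.exp b) := by
  have h1 : (1 : ℝ≥0∞) ≤ ENNReal.ofReal (Real.exp b) := by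
    rw [← ENNReal.ofReal_one]
    exact ENNReal.ofReal_le_ofReal (Real.one_le_exp hb)
  calc x ^ p ≤ ENNReal.ofReal (Real.exp a) ^ p := ENNReal.rpow_le_rpow hx hp0
    _ ≤ ENNReal.ofReal (Real.exp b) ^ p :=
        ENNReal.rpow_le_rpow (ENNReal.ofReal_le_ofReal (Real.exp_le_exp.2 hab)) hp0
    _ ≤ ENNReal.ofReal (Real.exp b) ^ (1 : ℝ) := ENNReal.rpow_le_rpow_of_exponent_le h1 hp1
    _ = ENNReal.ofReal (Real.exp b) := ENNReal.rpow_one _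

/-- **The RG step (S1 + S2 + S3): a uniform doubling gain for the bounded class gives the window LD for the
bounded class, with the class-uniform tilt range `min t₀ β₁`.** For `G ∈ 𝒢(C')` with base scale `τ₀`
and gain `η < 1`: the one-site Gaussian bound (`stub_oneSiteGauss`, range `t₀(C')`) and the static
reduction (`stub_staticReduction`) give the quadratic seed at every window, the hypothesis gives the
dyadic doubling inequalities, and `stub_bookkeeping` concludes. [folklore] -/
theorem boundedWindowLD_of_doublingGainBounded :
    (∃ σ₀ : ℝ, 0 < σ₀ ∧ ∀ (a₀ θ₀ : ℝ) (u₀ : V3), 0 < a₀ → 0 < θ₀ → ∀ σ : ℝ, 0 < σ → σ < σ₀ →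
      ∀ Φ : (N : ℕ) → HardSphereFlow (Torus.geometry (Fin 3)) (hsDiameter σ N) (N + 1),
      ∀ C' : ℝ, 0 ≤ C' → ∃ β₁ : ℝ, 0 < β₁ ∧
      ∀ G : T3 × V3 → ℝ, Continuous G → (∀ y, |G y| ≤ C' * (1 + ‖y.2‖ ^ 2)) →
      (∃ R : ℝ, ∀ y : T3 × V3, R ≤ ‖y.2‖ → G y = 0) →
      (∀ x, ∫ v, G (x, v) * localMaxwellian 1 θ₀ u₀ v = 0) →
      (∀ x (j : Fin 3), ∫ v, G (x, v) * v j * localMaxwellian 1 θ₀ u₀ v = 0) →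
      (∀ x, ∫ v, G (x, v) * ‖v‖ ^ 2 * localMaxwellian 1 θ₀ u₀ v = 0) →
      ∃ τ₀ : ℝ, 0 < τ₀ ∧ ∃ η : ℝ, 0 ≤ η ∧ η < 1 ∧
        ∀ j : ℕ, ∀ β : ℝ, |β| ≤ β₁ → ∀ δ : ℝ, 0 < δ → ∃ N₀ : ℕ, ∀ N : ℕ, N₀ ≤ N →
          ∫⁻ z, ENNReal.ofReal (Real.exp (β * ∑ i : Fin (N + 1),
              (2 * (2 ^ j * τ₀) * ((N : ℝ) + 1) ^ (-(1 / 3 : ℝ)))⁻¹ *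
                ∫ r in (0 : ℝ)..(2 * (2 ^ j * τ₀) * ((N : ℝ) + 1) ^ (-(1 / 3 : ℝ))),
                  G (((Φ N).flow r z) i)))
            ∂(localGibbsLaw σ (fun _ => a₀) (fun _ => u₀) (fun _ => θ₀) N (Φ N)) ≤
          ENNReal.ofReal (Real.exp (δ * ((N : ℝ) + 1))) *
            (∫⁻ z, ENNReal.ofReal (Real.exp (β / 2 * ∑ i : Fin (N + 1),
                (2 ^ j * τ₀ * ((N : ℝ) + 1) ^ (-(1 / 3 : ℝ)))⁻¹ *
                  ∫ r in (0 : ℝ)..(2 ^ j * τ₀ * ((N : ℝ) + 1) ^ (-(1 / 3 : ℝ))),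
                    G (((Φ N).flow r z) i)))
              ∂(localGibbsLaw σ (fun _ => a₀) (fun _ => u₀) (fun _ => θ₀) N (Φ N))) ^
              (2 * (1 + η))) →
    ∃ σ₀ : ℝ, 0 < σ₀ ∧ ∀ (a₀ θ₀ : ℝ) (u₀ : V3), 0 < a₀ → 0 < θ₀ → ∀ σ : ℝ, 0 < σ → σ < σ₀ →
      ∀ Φ : (N : ℕ) → HardSphereFlow (Torus.geometry (Fin 3)) (hsDiameter σ N) (N + 1),
      ∀ C' : ℝ, 0 ≤ C' → ∃ β₁ : ℝ, 0 < β₁ ∧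
      ∀ G : T3 × V3 → ℝ, Continuous G → (∀ y, |G y| ≤ C' * (1 + ‖y.2‖ ^ 2)) →
      (∃ R : ℝ, ∀ y : T3 × V3, R ≤ ‖y.2‖ → G y = 0) →
      (∀ x, ∫ v, G (x, v) * localMaxwellian 1 θ₀ u₀ v = 0) →
      (∀ x (j : Fin 3), ∫ v, G (x, v) * v j * localMaxwellian 1 θ₀ u₀ v = 0) →
      (∀ x, ∫ v, G (x, v) * ‖v‖ ^ 2 * localMaxwellian 1 θ₀ u₀ v = 0) →
      ∀ β : ℝ, |β| ≤ β₁ → ∀ ε : ℝ, 0 < ε → ∃ τ : ℝ, 0 < τ ∧ ∃ N₀ : ℕ, ∀ N : ℕ, N₀ ≤ N →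
        ∫⁻ z, ENNReal.ofReal (Real.exp (β * ∑ i : Fin (N + 1),
            (τ * ((N : ℝ) + 1) ^ (-(1 / 3 : ℝ)))⁻¹ *
              ∫ r in (0 : ℝ)..(τ * ((N : ℝ) + 1) ^ (-(1 / 3 : ℝ))), G (((Φ N).flow r z) i)))
          ∂(localGibbsLaw σ (fun _ => a₀) (fun _ => u₀) (fun _ => θ₀) N (Φ N)) ≤
          ENNReal.ofReal (Real.exp (ε * ((N : ℝ) + 1))) := by
  intro h4all
  obtain ⟨σ₀, hσ₀, h4⟩ := h4all
  refine ⟨min σ₀ (1 / 2), lt_min hσ₀ (by norm_num), ?_⟩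
  intro a₀ θ₀ u₀ ha hθ σ hσ hσlt Φ C' hC'
  have hσ₀' : σ < σ₀ := hσlt.trans_le (min_le_left _ _)
  have hσ2 : σ ≤ 1 / 2 := (hσlt.trans_le (min_le_right _ _)).le
  -- S4': the uniform tilt range of the bounded class `𝒢(C')`
  obtain ⟨β₁, hβ₁, hdblG⟩ := h4 a₀ θ₀ u₀ ha hθ σ hσ hσ₀' Φ C' hC'
  -- S2: the one-site Gaussian range and constant for the growth constant `C'`
  obtain ⟨t₀, ht₀, K, hK, hone⟩ := stub_oneSiteGauss hθ u₀ hC'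
  refine ⟨min t₀ β₁, lt_min ht₀ hβ₁, ?_⟩
  intro G hG hGC hGs hG0 hG1 hG2
  obtain ⟨τ₀, hτ₀, η, hη0, hη1, hdbl⟩ := hdblG G hG hGC hGs hG0 hG1 hG2
  have honeG : ∀ β : ℝ, |β| ≤ t₀ → ∀ x : T3,
      ∫⁻ v, ENNReal.ofReal (Real.exp (β * G (x, v))) ∂(gaussMeasure u₀ θ₀) ≤
        ENNReal.ofReal (Real.exp (K * β ^ 2)) := fun β hβ x =>
    hone (fun v => G (x, v)) (hG.measurable.comp (measurable_const.prodMk measurable_id))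
      (fun v => hGC (x, v)) (hG0 x) β hβ
  set M : ℝ → ℝ → ℕ → ℝ≥0∞ := fun β τ N =>
    ∫⁻ z, ENNReal.ofReal (Real.exp (β * ∑ i : Fin (N + 1),
        (τ * ((N : ℝ) + 1) ^ (-(1 / 3 : ℝ)))⁻¹ *
          ∫ r in (0 : ℝ)..(τ * ((N : ℝ) + 1) ^ (-(1 / 3 : ℝ))), G (((Φ N).flow r z) i)))
      ∂(localGibbsLaw σ (fun _ => a₀) (fun _ => u₀) (fun _ => θ₀) N (Φ N)) with hM
  have hseed : ∀ β : ℝ, |β| ≤ min t₀ β₁ → ∀ τ : ℝ, 0 < τ → ∀ N : ℕ,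
      M β τ N ≤ ENNReal.ofReal (Real.exp (K * β ^ 2 * ((N : ℝ) + 1))) := by
    intro β hβ τ hτ N
    simp only [hM]
    exact stub_staticReduction ha hθ u₀ hσ2 N (Φ N) hG (honeG β (hβ.trans (min_le_left _ _))) hτ
  have hdbl' : ∀ j : ℕ, ∀ β : ℝ, |β| ≤ min t₀ β₁ → ∀ δ : ℝ, 0 < δ → ∃ N₀ : ℕ, ∀ N : ℕ, N₀ ≤ N →
      M β (2 * (2 ^ j * τ₀)) N ≤
        ENNReal.ofReal (Real.exp (δ * ((N : ℝ) + 1))) *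
          M (β / 2) (2 ^ j * τ₀) N ^ (2 * (1 + η)) := by
    intro j β hβ δ hδ
    simp only [hM]
    exact hdbl j β (hβ.trans (min_le_right _ _)) δ hδ
  have hdecay := stub_bookkeeping M (lt_min ht₀ hβ₁) hK hτ₀ hη0 hη1 hseed hdbl'
  intro β hβ ε hε
  obtain ⟨τ, hτ, N₀, hN⟩ := hdecay β hβ ε hε
  refine ⟨τ, hτ, N₀, fun N hNN => ?_⟩
  have := hN N hNN
  simpa only [hM] using this

/-- **The normal-form step (NF-a1 + NF-a2 + NF-b + S3): the crux follows from its own restriction to the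
bounded class with a class-uniform tilt range.** If at every small reduced density, for all constant
profiles, every family of flows and every `C' ≥ 0` there is `β₁(C') > 0` such that EVERY `G ∈ 𝒢(C')`
(continuous, `|G(x,v)| ≤ C'(1+|v|²)`, compact `v`-support, `M_{1,u₀,θ₀}`-orthogonal at every `x` to
`1, v_j, |v|²`) satisfies the crux's conclusion for all `|β| ≤ β₁`, then the crux holds for every fast
`F` of quadratic growth: `β₀ = min (β₁/2) (μ₀/2)` with `β₁ = β₁(C+1)` and `μ₀` the tail tilt range of
`stub_truncation`; given `β ≠ 0`, `ε`, split `F = G + T` at tail size `ε/2` and apply `stub_holderSplit`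
with the β-proportional weight `ϑ = |β|/μ₀ ≤ ½` — the `T`-factor is static at the fixed tilt `±μ₀`
(`stub_staticReduction`), the `G`-factor is the hypothesis at tilt `β/(1−ϑ)`, `|β/(1−ϑ)| ≤ 2|β| ≤ β₁`.
The uniformity of `β₁` over `𝒢(C')` is used: `G` depends on `ε` through the truncation radius, `β₀`
does not. [folklore] -/
theorem EquilibriumFastWindowLD_of_boundedWindowLD :
    (∃ σ₀ : ℝ, 0 < σ₀ ∧ ∀ (a₀ θ₀ : ℝ) (u₀ : V3), 0 < a₀ → 0 < θ₀ → ∀ σ : ℝ, 0 < σ → σ < σ₀ →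
      ∀ Φ : (N : ℕ) → HardSphereFlow (Torus.geometry (Fin 3)) (hsDiameter σ N) (N + 1),
      ∀ C' : ℝ, 0 ≤ C' → ∃ β₁ : ℝ, 0 < β₁ ∧
      ∀ G : T3 × V3 → ℝ, Continuous G → (∀ y, |G y| ≤ C' * (1 + ‖y.2‖ ^ 2)) →
      (∃ R : ℝ, ∀ y : T3 × V3, R ≤ ‖y.2‖ → G y = 0) →
      (∀ x, ∫ v, G (x, v) * localMaxwellian 1 θ₀ u₀ v = 0) →
      (∀ x (j : Fin 3), ∫ v, G (x, v) * v j * localMaxwellian 1 θ₀ u₀ v = 0) →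
      (∀ x, ∫ v, G (x, v) * ‖v‖ ^ 2 * localMaxwellian 1 θ₀ u₀ v = 0) →
      ∀ β : ℝ, |β| ≤ β₁ → ∀ ε : ℝ, 0 < ε → ∃ τ : ℝ, 0 < τ ∧ ∃ N₀ : ℕ, ∀ N : ℕ, N₀ ≤ N →
        ∫⁻ z, ENNReal.ofReal (Real.exp (β * ∑ i : Fin (N + 1),
            (τ * ((N : ℝ) + 1) ^ (-(1 / 3 : ℝ)))⁻¹ *
              ∫ r in (0 : ℝ)..(τ * ((N : ℝ) + 1) ^ (-(1 / 3 : ℝ))), G (((Φ N).flow r z) i)))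
          ∂(localGibbsLaw σ (fun _ => a₀) (fun _ => u₀) (fun _ => θ₀) N (Φ N)) ≤
          ENNReal.ofReal (Real.exp (ε * ((N : ℝ) + 1)))) →
    Summit.AtomisticToContinuum.HydrodynamicLimit.Theses.TwoClocks.EquilibriumFastWindowLD := by
  intro hW
  obtain ⟨σ₀, hσ₀, hWσ⟩ := hW
  refine ⟨min σ₀ (1 / 2), lt_min hσ₀ (by norm_num), ?_⟩
  intro a₀ θ₀ u₀ ha hθ σ hσ hσlt Φ F hF hFC hF0 hF1 hF2
  have hσ₀' : σ < σ₀ := hσlt.trans_le (min_le_left _ _)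
  have hσ2 : σ ≤ 1 / 2 := (hσlt.trans_le (min_le_right _ _)).le
  obtain ⟨C, hC⟩ := hFC
  -- the growth constant may be taken nonnegative
  set C₀ : ℝ := max C 0 with hC₀
  have hC₀0 : 0 ≤ C₀ := le_max_right _ _
  have hC' : ∀ y, |F y| ≤ C₀ * (1 + ‖y.2‖ ^ 2) := fun y =>
    (hC y).trans (mul_le_mul_of_nonneg_right (le_max_left _ _) (by positivity))
  -- NF-a1: a bounded dual family to the collision invariants at `(θ₀, u₀)`
  obtain ⟨ψ₀, ψ₂, ψ₁, hψ₀c, hψ₂c, hψ₁c, hψs, h00, h01, h02, h10, h11, h12, h20, h21, h22⟩ :=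
    stub_dualFamily hθ u₀
  -- NF-a2: the truncation data of `F` (tilt range `μ₀` fixed before the tail size `ϖ`)
  obtain ⟨μ₀, hμ₀, htr⟩ := stub_truncation hθ u₀ hC₀0 hψ₀c hψ₂c hψ₁c hψs h00 h01 h02 h10 h11 h12
    h20 h21 h22 F hF hC' hF0 hF1 hF2
  -- the hypothesis: the class-uniform tilt range `b = β₁(C₀ + 1)` of `𝒢(C₀ + 1)` and the decay
  obtain ⟨b, hb0, hWD⟩ := hWσ a₀ θ₀ u₀ ha hθ σ hσ hσ₀' Φ (C₀ + 1) (by positivity)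
  -- the tilt range of the datum
  refine ⟨min (b / 2) (μ₀ / 2), lt_min (half_pos hb0) (half_pos hμ₀), ?_⟩
  intro β hβ ε hε
  have hβb : |β| ≤ b / 2 := hβ.trans (min_le_left _ _)
  have hβμ : |β| ≤ μ₀ / 2 := hβ.trans (min_le_right _ _)
  by_cases hβ0 : β = 0
  · -- trivial tilt: the moment is the total mass `1`
    subst hβ0
    refine ⟨1, one_pos, 0, fun N _ => ?_⟩
    haveI := isProbabilityMeasure_localGibbsLaw (a₀ := fun _ => a₀) (θ₀ := fun _ => θ₀)
      (u₀ := fun _ => u₀) continuous_const continuous_const continuous_const (fun _ => ha)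
      (fun _ => hθ) hσ2 N (Φ N)
    simp only [zero_mul, Real.exp_zero, ENNReal.ofReal_one, lintegral_const, measure_univ,
      mul_one]
    rw [← ENNReal.ofReal_one]
    exact ENNReal.ofReal_le_ofReal (Real.one_le_exp (by positivity))
  -- the β-proportional Hölder weight
  have hβpos : 0 < |β| := abs_pos.2 hβ0
  set ϑ : ℝ := |β| / μ₀ with hϑ
  have hϑ0 : 0 < ϑ := div_pos hβpos hμ₀
  have hϑhalf : ϑ ≤ 1 / 2 := by
    rw [hϑ, div_le_iff₀ hμ₀]
    linarith
  have hϑ1 : ϑ < 1 := hϑhalf.trans_lt (by norm_num)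
  have h1ϑ : 0 < 1 - ϑ := by linarith
  -- split `F = G + T` with tail size `ϖ = ε / 2`
  obtain ⟨G, T, hFGT, hG, hT, hGC, hGs, hG0, hG1, hG2, hTone⟩ := htr (ε / 2) (half_pos hε)
  -- the `G`-factor: bounded-class decay at tilt `β / (1 - ϑ)`, slack `ε / 2`
  have hβ' : |β / (1 - ϑ)| ≤ b := by
    rw [abs_div, abs_of_pos h1ϑ, div_le_iff₀ h1ϑ]
    have h2 : (1 : ℝ) / 2 ≤ 1 - ϑ := by linarith
    nlinarith [hβb, hb0, abs_nonneg β]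
  obtain ⟨τ, hτ, N₀, hN⟩ := hWD G hG hGC hGs hG0 hG1 hG2 (β / (1 - ϑ)) hβ' (ε / 2) (half_pos hε)
  refine ⟨τ, hτ, N₀, fun N hNN => ?_⟩
  have hw : 0 < τ * ((N : ℝ) + 1) ^ (-(1 / 3 : ℝ)) :=
    mul_pos hτ (Real.rpow_pos_of_pos (by positivity) _)
  -- the `T`-factor is static, at the fixed tilt `β / ϑ = ± μ₀`
  have hβϑ : |β / ϑ| = μ₀ := by
    rw [abs_div, abs_of_pos hϑ0, hϑ]
    field_simp
  have hK' : ε / 2 / μ₀ ^ 2 * (β / ϑ) ^ 2 = ε / 2 := by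
    rw [← sq_abs (β / ϑ), hβϑ]
    field_simp
  have hToneK : ∀ x : T3,
      ∫⁻ v, ENNReal.ofReal (Real.exp (β / ϑ * T (x, v))) ∂(gaussMeasure u₀ θ₀) ≤
        ENNReal.ofReal (Real.exp (ε / 2 / μ₀ ^ 2 * (β / ϑ) ^ 2)) := by
    intro x
    rw [hK']
    exact hTone x (β / ϑ) hβϑ.le
  have hTstat := stub_staticReduction ha hθ u₀ hσ2 N (Φ N) hT hToneK hτ
  rw [hK'] at hTstat
  -- assemble: rewrite `F`, Hölder, and bound the two factors
  have hεN : 0 ≤ ε / 2 * ((N : ℝ) + 1) := by positivity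
  simp only [hFGT]
  calc ∫⁻ z, ENNReal.ofReal (Real.exp (β * ∑ i : Fin (N + 1),
          (τ * ((N : ℝ) + 1) ^ (-(1 / 3 : ℝ)))⁻¹ *
            ∫ r in (0 : ℝ)..(τ * ((N : ℝ) + 1) ^ (-(1 / 3 : ℝ))),
              (G (((Φ N).flow r z) i) + T (((Φ N).flow r z) i))))
        ∂(localGibbsLaw σ (fun _ => a₀) (fun _ => u₀) (fun _ => θ₀) N (Φ N))
      ≤ (∫⁻ z, ENNReal.ofReal (Real.exp (β / (1 - ϑ) * ∑ i : Fin (N + 1),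
            (τ * ((N : ℝ) + 1) ^ (-(1 / 3 : ℝ)))⁻¹ *
              ∫ r in (0 : ℝ)..(τ * ((N : ℝ) + 1) ^ (-(1 / 3 : ℝ))), G (((Φ N).flow r z) i)))
          ∂(localGibbsLaw σ (fun _ => a₀) (fun _ => u₀) (fun _ => θ₀) N (Φ N))) ^ (1 - ϑ) *
        (∫⁻ z, ENNReal.ofReal (Real.exp (β / ϑ * ∑ i : Fin (N + 1),
            (τ * ((N : ℝ) + 1) ^ (-(1 / 3 : ℝ)))⁻¹ *
              ∫ r in (0 : ℝ)..(τ * ((N : ℝ) + 1) ^ (-(1 / 3 : ℝ))), T (((Φ N).flow r z) i)))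
          ∂(localGibbsLaw σ (fun _ => a₀) (fun _ => u₀) (fun _ => θ₀) N (Φ N))) ^ ϑ :=
        stub_holderSplit σ a₀ θ₀ u₀ N (Φ N) hG hT β hϑ0 hϑ1 hw
    _ ≤ ENNReal.ofReal (Real.exp (ε / 2 * ((N : ℝ) + 1))) *
        ENNReal.ofReal (Real.exp (ε / 2 * ((N : ℝ) + 1))) := by
        gcongr
        · exact rpow_le_ofReal_exp_of_le_of_nonneg (hN N hNN) le_rfl hεN h1ϑ.le (by linarith)
        · exact rpow_le_ofReal_exp_of_le_of_nonneg hTstat le_rfl hεN hϑ0.le hϑ1.le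
    _ = ENNReal.ofReal (Real.exp (ε * ((N : ℝ) + 1))) := by
        rw [← ENNReal.ofReal_mul (Real.exp_nonneg _), ← Real.exp_add,
          show ε / 2 * ((N : ℝ) + 1) + ε / 2 * ((N : ℝ) + 1) = ε * ((N : ℝ) + 1) by ring]

/-- **`EquilibriumFastWindowLD` from a uniform doubling gain for bounded fast observables**
(composition of the line `Sketch`, skeleton rev 2 = registered sub-goal; the RG step followed by the
normal-form step). [folklore] -/
theorem EquilibriumFastWindowLD_of_doublingGainBounded :
    (∃ σ₀ : ℝ, 0 < σ₀ ∧ ∀ (a₀ θ₀ : ℝ) (u₀ : V3), 0 < a₀ → 0 < θ₀ → ∀ σ : ℝ, 0 < σ → σ < σ₀ →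
      ∀ Φ : (N : ℕ) → HardSphereFlow (Torus.geometry (Fin 3)) (hsDiameter σ N) (N + 1),
      ∀ C' : ℝ, 0 ≤ C' → ∃ β₁ : ℝ, 0 < β₁ ∧
      ∀ G : T3 × V3 → ℝ, Continuous G → (∀ y, |G y| ≤ C' * (1 + ‖y.2‖ ^ 2)) →
      (∃ R : ℝ, ∀ y : T3 × V3, R ≤ ‖y.2‖ → G y = 0) →
      (∀ x, ∫ v, G (x, v) * localMaxwellian 1 θ₀ u₀ v = 0) →
      (∀ x (j : Fin 3), ∫ v, G (x, v) * v j * localMaxwellian 1 θ₀ u₀ v = 0) →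
      (∀ x, ∫ v, G (x, v) * ‖v‖ ^ 2 * localMaxwellian 1 θ₀ u₀ v = 0) →
      ∃ τ₀ : ℝ, 0 < τ₀ ∧ ∃ η : ℝ, 0 ≤ η ∧ η < 1 ∧
        ∀ j : ℕ, ∀ β : ℝ, |β| ≤ β₁ → ∀ δ : ℝ, 0 < δ → ∃ N₀ : ℕ, ∀ N : ℕ, N₀ ≤ N →
          ∫⁻ z, ENNReal.ofReal (Real.exp (β * ∑ i : Fin (N + 1),
              (2 * (2 ^ j * τ₀) * ((N : ℝ) + 1) ^ (-(1 / 3 : ℝ)))⁻¹ *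
                ∫ r in (0 : ℝ)..(2 * (2 ^ j * τ₀) * ((N : ℝ) + 1) ^ (-(1 / 3 : ℝ))),
                  G (((Φ N).flow r z) i)))
            ∂(localGibbsLaw σ (fun _ => a₀) (fun _ => u₀) (fun _ => θ₀) N (Φ N)) ≤
          ENNReal.ofReal (Real.exp (δ * ((N : ℝ) + 1))) *
            (∫⁻ z, ENNReal.ofReal (Real.exp (β / 2 * ∑ i : Fin (N + 1),
                (2 ^ j * τ₀ * ((N : ℝ) + 1) ^ (-(1 / 3 : ℝ)))⁻¹ *
                  ∫ r in (0 : ℝ)..(2 ^ j * τ₀ * ((N : ℝ) + 1) ^ (-(1 / 3 : ℝ))),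
                    G (((Φ N).flow r z) i)))
              ∂(localGibbsLaw σ (fun _ => a₀) (fun _ => u₀) (fun _ => θ₀) N (Φ N))) ^
              (2 * (1 + η))) →
    Summit.AtomisticToContinuum.HydrodynamicLimit.Theses.TwoClocks.EquilibriumFastWindowLD :=
  fun h4all => EquilibriumFastWindowLD_of_boundedWindowLD (boundedWindowLD_of_doublingGainBounded h4all)

end Summit.AtomisticToContinuum.HydrodynamicLimit.Theorems.FastWindowRG

end
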